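import Mathlib.Analysis.Fourier.Inversion
import Mathlib.Analysis.Fourier.FourierTransformDeriv
import Mathlib.Analysis.Distribution.SchwartzSpace.Fourier
import Mathlib.Analysis.SpecialFunctions.Pow.Integral
import Mathlib.Analysis.SpecialFunctions.Integrals.Basic
import Mathlib.Analysis.SpecialFunctions.ImproperIntegrals
import Mathlib.MeasureTheory.Integral.MeanInequalities
import Literature.Analysis.FunctionSpaces.PlancherelL1L2
import Literature.Analysis.FluidPDE.SobolevWholeSpace
import Literature.Analysis.FluidPDE.MollifiedLimits
import Mathlib.Analysis.Calculus.FDeriv.Measurable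
import HarnessLib

/-!
# The bilinear Fourier–Lebesgue estimate `∫ ‖ξ‖⁻¹ |𝓕(fg)(ξ)| dξ ≲ ‖∇f‖₂ ‖∇g‖₂` on `ℝ³`

First file of the discharge of the named fact `NS.tao2011_duhamelNonlinearSpeed_unit`
(`TaoBoundedTotalSpeed.lean`): the nonlinear part (9.7) of Tao's proof of the bounded total speed
property, Tao 2011 (arXiv:1108.1165), Prop. 9.1 = arXiv Prop. 52, pp. 27–28:
"`‖∫₀ᵗ e^{(t−t')Δ} O(P∇(uu))(t') dt'‖_{L¹_t L^∞_x} ≲ E₀`". Tao proves (9.7) by a Littlewood–Paley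
decomposition, the frequency-localised heat decay, Bernstein's inequality, the paraproduct
trichotomy and, finally, "Schur's test (or Young's inequality)" applied to
`∑_{N₁} ∑_{N₂ ≲ N₁} (N₂/N₁)^{1/2} a_{N₁} a_{N₂}`, `a_N = ‖∇u_N‖_{L²_t L²_x}`, `∑_N a_N² ≲ E₀`.

Passing to the Fourier side *before* discretising in frequency, the heat factor integrates out
exactly (`∫_s^T e^{-4π²(t-s)|ξ|²} |ξ| dt ≤ (4π²|ξ|)⁻¹`, next files) and the whole dyadic
computation collapses to a single bilinear estimate, which this file proves:

  `∫_{ℝ³} ‖ξ‖⁻¹ |𝓕(f g)(ξ)| dξ ≤ (J / (2π)²) ‖∇f‖_{L²} ‖∇g‖_{L²}`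
  (`NS.lintegral_inv_norm_enorm_fourier_mul_le`, smooth real `f, g ∈ L²(ℝ³)` with `∇f, ∇g ∈ L²`).

Proof: `𝓕(fg) = 𝓕f ∗ 𝓕g` (`NS.fourier_mul_eq_integral`: Fourier inversion and Fubini), so with
`a(ζ) = ‖ζ‖ |𝓕g(ζ)|`, `b(η) = ‖η‖ |𝓕f(η)|` (both in `L²` with `‖a‖₂ = ‖∇g‖₂/(2π)` by Plancherel,
`NS.lintegral_norm_sq_mul_enorm_fourier_sq`) the left side is at most
`∫∫ a(ξ−η) b(η) / (‖ξ‖ ‖ξ−η‖ ‖η‖) dη dξ`; the kernel `k(ξ,η) = (‖ξ‖‖ξ−η‖‖η‖)⁻¹` is homogeneous of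
degree `−3 = −dim`, and **Schur's test** with the weight `‖·‖^{-3/2}`
(`NS.lintegral_lintegral_schurKernel_mul_mul_le`) bounds the double integral by `J ‖a‖₂ ‖b‖₂`,
the row/column sums reducing by scaling to the Newtonian-type potential
`∫ ‖η‖^{-5/2} ‖ζ+η‖⁻¹ dη ≤ 11 · 4π · ‖ζ‖^{-1/2}` (`NS.lintegral_potential_le`; exact value `16π‖ζ‖^{-1/2}`
by Newton's shell theorem, not needed). The estimate is first proved for Schwartz functions
(`NS.lintegral_inv_norm_enorm_fourier_mul_le_schwartz`) and then transferred to smooth `H¹ ∩ L²`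
functions by the truncations `χ_R f` of `Fluid.cutoff` and Fatou's lemma (`R → ∞`).

## Main statements

* `NS.lintegral_ball_norm_rpow_neg`, `NS.lintegral_compl_ball_norm_rpow_neg`: the radial power
  integrals `∫_{B_ρ} ‖x‖^{-α} = 4πρ^{3-α}/(3-α)` (`α < 3`), `∫_{B_ρᶜ} ‖x‖^{-α} = 4πρ^{3-α}/(α-3)` (`α > 3`).
* `NS.lintegral_potential_le`: the potential bound above.
* `NS.lintegral_lintegral_schurKernel_mul_mul_le`: Schur's test for `k`.
* `NS.fourier_mul_eq_integral`: `𝓕(φψ)(ξ) = ∫ 𝓕φ(η) 𝓕ψ(ξ−η) dη` (any finite-dimensional space).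
* `NS.lintegral_norm_sq_mul_enorm_fourier_sq`: `∫ (2π‖ξ‖)² |𝓕φ|² = ∑ᵢ ∫ |∂ᵢφ|²` (Schwartz `φ`).
* `NS.lintegral_inv_norm_enorm_fourier_mul_le_schwartz`, `NS.lintegral_inv_norm_enorm_fourier_mul_le`:
  the bilinear estimate, for Schwartz functions and for smooth `f, g ∈ L²` with `∇f, ∇g ∈ L²`.

## Mathlib / tree search

Mathlib: `integral_fun_norm_addHaar` (polar coordinates for radial functions),
`integrableOn_ball_of_norm_le_rpow`, `integral_rpow`, `integral_Ioi_rpow_of_lt`,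
`ENNReal.lintegral_mul_le_Lp_mul_Lq` (Hölder), `lintegral_prod`, `lintegral_lintegral_swap`,
`lintegral_add_right_eq_self`, `Continuous.fourierInv_fourier_eq` (inversion),
`Real.fourier_mul_convolution_eq` (only the dual direction `𝓕(f∗g) = 𝓕f·𝓕g`),
`SchwartzMap.fourier_lineDerivOp_eq`, `HasCompactSupport.toSchwartzMap`, `lintegral_liminf_le`
(Fatou), `tendsto_integral_of_dominated_convergence`; no Schur test and no `𝓕(fg) = 𝓕f ∗ 𝓕g` in
Mathlib (searched `schur`, `fourier_mul`, `convolution` in `Analysis/Fourier`). Tree: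
`Literature.Analysis.FunctionSpaces.lintegral_enorm_sq_fourierIntegral_eq`, `Literature.Analysis.FunctionSpaces.continuous_fourierIntegral`
(`FunctionSpaces/PlancherelL1L2`), `Fluid.cutoff`, `Fluid.exists_norm_fderiv_cutoff_le`,
`Fluid.tendsto_cutoff_natCast_add_one` (`FluidPDE/WholeSpaceIBP`),
`Fluid.eLpNorm_fderiv_cutoff_smul_le` (`FluidPDE/SobolevWholeSpace`), `Fluid.eLpNorm_two_eq_rpow`
(`FluidPDE/MollifiedLimits`).

## References

* T. Tao, *Localisation and compactness properties of the Navier–Stokes global regularity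
  problem*, Anal. PDE 6 (2013) 25–107 = arXiv:1108.1165 (`Tao2011`), §9, proof of Prop. 9.1
  (arXiv Prop. 52), pp. 27–28, (9.7) and the Schur-test conclusion.
* E. M. Stein, *Singular Integrals and Differentiability Properties of Functions* (1970),
  Appendix A.1 (Schur's lemma) — the form of Schur's test used here. [folklore]
-/

noncomputable section

open MeasureTheory Set Function Filter Topology Metric Real
open scoped ENNReal NNReal FourierTransform RealInnerProductSpace

namespace Literature.Analysis.FluidPDE

/-- Local notation for `ℝ³ = EuclideanSpace ℝ (Fin 3)`. -/
local notation "ℝ³" => EuclideanSpace ℝ (Fin 3)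

/-! ## Radial power integrals on `ℝ³` -/

/-- `3 · vol(B(0,1))`, the area of the unit sphere of `ℝ³` (`= 4π`, not needed explicitly). [folklore] -/
def threeVolBall : ℝ := 3 * (volume : Measure ℝ³).real (ball (0 : ℝ³) 1)

/-- `threeVolBall > 0`. [folklore] -/
theorem threeVolBall_pos : 0 < threeVolBall := by
  have h : 0 < (volume : Measure ℝ³).real (ball (0 : ℝ³) 1) :=
    ENNReal.toReal_pos (measure_ball_pos volume (0 : ℝ³) one_pos).ne' measure_ball_lt_top.ne
  unfold threeVolBall; positivity

/-- `dim ℝ³ = 3`. [folklore] -/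
theorem finrank_R3 : Module.finrank ℝ ℝ³ = 3 := finrank_euclideanSpace_fin

/-- Polar coordinates for a radial function on `ℝ³`:
`∫ f(‖x‖) dx = threeVolBall · ∫₀^∞ y² f(y) dy`. [folklore] -/
theorem integral_radial_R3 (f : ℝ → ℝ) :
    ∫ x : ℝ³, f ‖x‖ = threeVolBall * ∫ y in Ioi (0 : ℝ), y ^ 2 * f y := by
  have h := integral_fun_norm_addHaar (volume : Measure ℝ³) f
  rw [finrank_R3] at h
  rw [h, threeVolBall]
  simp only [nsmul_eq_mul, smul_eq_mul, Nat.cast_ofNat]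
  norm_num [mul_assoc]

/-- `∫_{B(0,ρ)} ‖x‖^{-α} dx = threeVolBall · ρ^{3-α}/(3-α)` for `α < 3`, as a Lebesgue integral. [folklore] -/
theorem lintegral_ball_norm_rpow_neg {α ρ : ℝ} (hα : α < 3) (hρ : 0 < ρ) :
    ∫⁻ x in ball (0 : ℝ³) ρ, ENNReal.ofReal (‖x‖ ^ (-α)) =
      ENNReal.ofReal (threeVolBall * (ρ ^ (3 - α) / (3 - α))) := by
  have hint : IntegrableOn (fun x : ℝ³ => ‖x‖ ^ (-α)) (ball 0 ρ) := by
    refine integrableOn_ball_of_norm_le_rpow (μ := volume) (by rw [finrank_R3]; norm_num)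
      (C := 1) (α := α) (by rw [finrank_R3]; exact_mod_cast hα)
      (Eventually.of_forall fun x => ?_)
      (continuous_norm.measurable.pow_const _).aestronglyMeasurable
    rw [Real.norm_of_nonneg (Real.rpow_nonneg (norm_nonneg _) _), one_mul]
  rw [← ofReal_integral_eq_lintegral_ofReal hint
    (Eventually.of_forall fun x => Real.rpow_nonneg (norm_nonneg _) _)]
  congr 1
  have h1 : ∫ x in ball (0 : ℝ³) ρ, ‖x‖ ^ (-α) =
      ∫ x : ℝ³, (Iio ρ).indicator (fun y : ℝ => y ^ (-α)) ‖x‖ := by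
    rw [← integral_indicator measurableSet_ball]
    congr 1 with x
    simp only [indicator, mem_ball_zero_iff, mem_Iio]
  rw [h1, integral_radial_R3]
  congr 1
  have h2 : ∫ y in Ioi (0 : ℝ), y ^ 2 * (Iio ρ).indicator (fun y : ℝ => y ^ (-α)) y =
      ∫ y in Ioo (0 : ℝ) ρ, y ^ (2 - α) := by
    rw [← integral_indicator measurableSet_Ioo, ← integral_indicator measurableSet_Ioi]
    congr 1 with y
    simp only [indicator, mem_Ioi, mem_Iio, mem_Ioo]
    by_cases hy : 0 < y
    · by_cases hyρ : y < ρ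
      · simp only [hy, hyρ, and_self, if_true]
        rw [Real.rpow_sub hy, Real.rpow_neg hy.le, div_eq_mul_inv, Real.rpow_two]
      · simp [hy, hyρ]
    · simp [hy]
  rw [h2, ← integral_Ioc_eq_integral_Ioo, ← intervalIntegral.integral_of_le hρ.le,
    integral_rpow (Or.inl (by linarith)), Real.zero_rpow (by linarith), sub_zero]
  congr 1 <;> ring_nf

/-- `∫_{ℝ³ \ B(0,ρ)} ‖x‖^{-α} dx = threeVolBall · ρ^{3-α}/(α-3)` for `3 < α`, as a Lebesgue integral. [folklore] -/
theorem lintegral_compl_ball_norm_rpow_neg {α ρ : ℝ} (hα : 3 < α) (hρ : 0 < ρ) :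
    ∫⁻ x in (ball (0 : ℝ³) ρ)ᶜ, ENNReal.ofReal (‖x‖ ^ (-α)) =
      ENNReal.ofReal (threeVolBall * (ρ ^ (3 - α) / (α - 3))) := by
  -- the radial profile
  set f : ℝ → ℝ := (Ici ρ).indicator fun y : ℝ => y ^ (-α) with hf
  have hfx : ∀ x : ℝ³, (ball (0 : ℝ³) ρ)ᶜ.indicator (fun x : ℝ³ => ‖x‖ ^ (-α)) x = f ‖x‖ := by
    intro x
    simp only [hf, indicator, mem_compl_iff, mem_ball_zero_iff, not_lt, mem_Ici]
  have h1d : IntegrableOn (fun y : ℝ => y ^ (2 - α)) (Ioi ρ) :=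
    integrableOn_Ioi_rpow_of_lt (by linarith) hρ
  have hprof : ∀ y ∈ Ioi (0 : ℝ), y ^ 2 * f y = (Ioi ρ).indicator (fun y : ℝ => y ^ (2 - α)) y ∨ y = ρ := by
    intro y hy
    by_cases hyρ : y = ρ
    · exact Or.inr hyρ
    left
    simp only [hf, indicator, mem_Ici, mem_Ioi]
    by_cases h : ρ < y
    · rw [if_pos h.le, if_pos h, Real.rpow_sub hy, Real.rpow_neg hy.out.le, div_eq_mul_inv,
        Real.rpow_two]
    · have : ¬ ρ ≤ y := fun h' => h (lt_of_le_of_ne h' (Ne.symm hyρ))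
      rw [if_neg this, if_neg h, mul_zero]
  have hae : (fun y : ℝ => y ^ 2 * f y) =ᵐ[volume.restrict (Ioi 0)]
      (Ioi ρ).indicator fun y : ℝ => y ^ (2 - α) := by
    have hρ0 : ∀ᵐ y ∂(volume.restrict (Ioi (0 : ℝ))), y ≠ ρ := by
      rw [ae_restrict_iff' measurableSet_Ioi]
      filter_upwards [(countable_singleton ρ).ae_notMem volume] with y hy _
      simpa using hy
    filter_upwards [ae_restrict_mem measurableSet_Ioi, hρ0] with y hy hne
    exact (hprof y hy).resolve_right hne
  have hint : Integrable (fun x : ℝ³ => f ‖x‖) := by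
    rw [integrable_fun_norm_addHaar volume (f := f), finrank_R3]
    simp only [Nat.add_one_sub_one, smul_eq_mul]
    exact Integrable.congr (h1d.integrable_indicator measurableSet_Ioi).integrableOn hae.symm
  have hint' : IntegrableOn (fun x : ℝ³ => ‖x‖ ^ (-α)) (ball (0 : ℝ³) ρ)ᶜ := by
    rw [← integrable_indicator_iff measurableSet_ball.compl]
    exact hint.congr (Eventually.of_forall fun x => (hfx x).symm)
  rw [← ofReal_integral_eq_lintegral_ofReal hint'
    (Eventually.of_forall fun x => Real.rpow_nonneg (norm_nonneg _) _)]
  congr 1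
  rw [← integral_indicator measurableSet_ball.compl, funext hfx, integral_radial_R3]
  congr 1
  rw [integral_congr_ae hae, integral_indicator measurableSet_Ioi,
    Measure.restrict_restrict measurableSet_Ioi,
    show Ioi ρ ∩ Ioi (0 : ℝ) = Ioi ρ from inter_eq_left.2 (Ioi_subset_Ioi hρ.le),
    integral_Ioi_rpow_of_lt (by linarith) hρ]
  rw [show 2 - α + 1 = 3 - α by ring]
  have h3 : (3 : ℝ) - α ≠ 0 := by linarith
  have h3' : α - 3 ≠ 0 := by linarith
  field_simp
  ring

/-- `∫_{B(0,ρ)} ‖y‖⁻¹ dy = threeVolBall · ρ²/2` on `ℝ³`. [folklore] -/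
theorem lintegral_ball_norm_inv {ρ : ℝ} (hρ : 0 < ρ) :
    ∫⁻ y in ball (0 : ℝ³) ρ, ENNReal.ofReal (‖y‖⁻¹) =
      ENNReal.ofReal (threeVolBall * (ρ ^ 2 / 2)) := by
  have h := lintegral_ball_norm_rpow_neg (α := 1) (by norm_num) hρ
  simp only [Real.rpow_neg_one] at h
  rw [h]
  norm_num

/-- `∫_{B(0,ρ)} ‖y‖^{-5/2} dy = 2 · threeVolBall · ρ^{1/2}` on `ℝ³`. [folklore] -/
theorem lintegral_ball_norm_rpow_neg_five_halves {ρ : ℝ} (hρ : 0 < ρ) :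
    ∫⁻ y in ball (0 : ℝ³) ρ, ENNReal.ofReal (‖y‖ ^ (-(5 / 2 : ℝ))) =
      ENNReal.ofReal (threeVolBall * (2 * ρ ^ (1 / 2 : ℝ))) := by
  rw [lintegral_ball_norm_rpow_neg (α := 5 / 2) (by norm_num) hρ]
  norm_num
  ring_nf

/-- `∫_{ℝ³ \ B(0,ρ)} ‖y‖^{-7/2} dy = 2 · threeVolBall · ρ^{-1/2}` on `ℝ³`. [folklore] -/
theorem lintegral_compl_ball_norm_rpow_neg_seven_halves {ρ : ℝ} (hρ : 0 < ρ) :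
    ∫⁻ y in (ball (0 : ℝ³) ρ)ᶜ, ENNReal.ofReal (‖y‖ ^ (-(7 / 2 : ℝ))) =
      ENNReal.ofReal (threeVolBall * (2 * ρ ^ (-(1 / 2) : ℝ))) := by
  rw [lintegral_compl_ball_norm_rpow_neg (α := 7 / 2) (by norm_num) hρ]
  norm_num
  ring_nf

/-! ## The Newtonian-type potential `∫ ‖η‖^{-5/2} ‖ζ + η‖⁻¹ dη ≲ ‖ζ‖^{-1/2}` -/

/-- Numeric `rpow` identities used below. [folklore] -/
theorem rpow_aux_one {r : ℝ} (hr : 0 < r) :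
    (r / 2) ^ (-(5 / 2 : ℝ)) * ((r / 2) ^ 2 / 2) ≤ r ^ (-(1 / 2) : ℝ) := by
  have h2 : (0 : ℝ) < r / 2 := by positivity
  have h1 : (r / 2) ^ (-(5 / 2 : ℝ)) * (r / 2) ^ 2 = (r / 2) ^ (-(1 / 2) : ℝ) := by
    rw [show ((r / 2) ^ 2 : ℝ) = (r / 2) ^ (2 : ℝ) by norm_cast, ← Real.rpow_add h2]
    norm_num
  have h3 : (r / 2) ^ (-(1 / 2) : ℝ) = r ^ (-(1 / 2) : ℝ) * 2 ^ ((1 / 2) : ℝ) := by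
    rw [Real.div_rpow hr.le zero_le_two, Real.rpow_neg zero_le_two, div_eq_mul_inv, inv_inv]
  have h4 : (2 : ℝ) ^ ((1 / 2) : ℝ) ≤ 2 := by
    calc (2 : ℝ) ^ ((1 / 2) : ℝ) ≤ 2 ^ (1 : ℝ) :=
          Real.rpow_le_rpow_of_exponent_le one_le_two (by norm_num)
      _ = 2 := Real.rpow_one 2
  have h5 : 0 ≤ r ^ (-(1 / 2) : ℝ) := Real.rpow_nonneg hr.le _
  calc (r / 2) ^ (-(5 / 2 : ℝ)) * ((r / 2) ^ 2 / 2)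
      = (r / 2) ^ (-(5 / 2 : ℝ)) * (r / 2) ^ 2 / 2 := by ring
    _ = r ^ (-(1 / 2) : ℝ) * 2 ^ ((1 / 2) : ℝ) / 2 := by rw [h1, h3]
    _ ≤ r ^ (-(1 / 2) : ℝ) * 2 / 2 := by gcongr
    _ = r ^ (-(1 / 2) : ℝ) := by ring

/-- Numeric `rpow` identities used below. [folklore] -/
theorem rpow_aux_two {r : ℝ} (hr : 0 < r) :
    2 / r * (2 * (4 * r) ^ (1 / 2 : ℝ)) = 8 * r ^ (-(1 / 2) : ℝ) := by
  have h4 : (4 * r) ^ (1 / 2 : ℝ) = 2 * r ^ (1 / 2 : ℝ) := by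
    rw [Real.mul_rpow (by norm_num) hr.le]
    congr 1
    rw [show (4 : ℝ) = 2 ^ (2 : ℝ) by norm_num, ← Real.rpow_mul zero_le_two]
    norm_num
  have h5 : r ^ (-(1 / 2) : ℝ) = r ^ (1 / 2 : ℝ) / r := by
    rw [show (-(1 / 2) : ℝ) = 1 / 2 - 1 by norm_num, Real.rpow_sub_one hr.ne']
  rw [h4, h5]
  field_simp
  ring

/-- Numeric `rpow` identities used below. [folklore] -/
theorem rpow_aux_three {r : ℝ} (hr : 0 < r) :
    4 / 3 * (2 * (4 * r) ^ (-(1 / 2) : ℝ)) = 4 / 3 * r ^ (-(1 / 2) : ℝ) := by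
  have h4 : (4 * r) ^ (-(1 / 2) : ℝ) = 2⁻¹ * r ^ (-(1 / 2) : ℝ) := by
    rw [Real.mul_rpow (by norm_num) hr.le]
    congr 1
    rw [show (4 : ℝ) = 2 ^ (2 : ℝ) by norm_num, ← Real.rpow_mul zero_le_two,
      show (2 : ℝ) * -(1 / 2) = -1 by norm_num, Real.rpow_neg_one]
  rw [h4]
  ring

/-- Pointwise splitting of the potential integrand into the near zone `‖ζ + η‖ < ‖ζ‖/2`, the
intermediate zone `‖η‖ < 4‖ζ‖` and the far zone `4‖ζ‖ ≤ ‖η‖`. [folklore] -/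
theorem potential_integrand_le {ζ : ℝ³} (hζ : ζ ≠ 0) (η : ℝ³) :
    ENNReal.ofReal (‖η‖ ^ (-(5 / 2 : ℝ)) * ‖ζ + η‖⁻¹) ≤
      (ball (-ζ) (‖ζ‖ / 2)).indicator
          (fun η => ENNReal.ofReal ((‖ζ‖ / 2) ^ (-(5 / 2 : ℝ)) * ‖ζ + η‖⁻¹)) η +
        (ball (0 : ℝ³) (4 * ‖ζ‖)).indicator
          (fun η => ENNReal.ofReal (2 / ‖ζ‖ * ‖η‖ ^ (-(5 / 2 : ℝ)))) η +
        (ball (0 : ℝ³) (4 * ‖ζ‖))ᶜ.indicator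
          (fun η => ENNReal.ofReal (4 / 3 * ‖η‖ ^ (-(7 / 2 : ℝ)))) η := by
  have hr : 0 < ‖ζ‖ := norm_pos_iff.2 hζ
  set r := ‖ζ‖ with hrdef
  have h52 : (-(5 / 2 : ℝ)) ≤ 0 := by norm_num
  by_cases hA : η ∈ ball (-ζ) (r / 2)
  · -- near zone
    have hA' : ‖ζ + η‖ < r / 2 := by
      rw [mem_ball, dist_eq_norm, sub_neg_eq_add, add_comm] at hA
      exact hA
    have hη : r / 2 ≤ ‖η‖ := by
      have h1 : ‖ζ‖ - ‖η‖ ≤ ‖ζ + η‖ := by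
        calc ‖ζ‖ - ‖η‖ = ‖ζ‖ - ‖-η‖ := by rw [norm_neg]
          _ ≤ ‖ζ - -η‖ := norm_sub_norm_le ζ (-η)
          _ = ‖ζ + η‖ := by rw [sub_neg_eq_add]
      linarith
    have hle : ‖η‖ ^ (-(5 / 2 : ℝ)) ≤ (r / 2) ^ (-(5 / 2 : ℝ)) :=
      Real.rpow_le_rpow_of_nonpos (by positivity) hη h52
    calc ENNReal.ofReal (‖η‖ ^ (-(5 / 2 : ℝ)) * ‖ζ + η‖⁻¹)
        ≤ ENNReal.ofReal ((r / 2) ^ (-(5 / 2 : ℝ)) * ‖ζ + η‖⁻¹) :=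
          ENNReal.ofReal_le_ofReal (mul_le_mul_of_nonneg_right hle (inv_nonneg.2 (norm_nonneg _)))
      _ = (ball (-ζ) (r / 2)).indicator
            (fun η => ENNReal.ofReal ((r / 2) ^ (-(5 / 2 : ℝ)) * ‖ζ + η‖⁻¹)) η := by
          rw [indicator_of_mem hA]
      _ ≤ _ := le_add_right (le_add_right le_rfl)
  · have hA' : r / 2 ≤ ‖ζ + η‖ := by
      rw [mem_ball, dist_eq_norm, sub_neg_eq_add, add_comm, not_lt] at hA
      exact hA
    by_cases hB : η ∈ ball (0 : ℝ³) (4 * r)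
    · -- intermediate zone
      have hle : ‖ζ + η‖⁻¹ ≤ 2 / r :=
        calc ‖ζ + η‖⁻¹ ≤ (r / 2)⁻¹ := inv_anti₀ (by positivity) hA'
          _ = 2 / r := inv_div r 2
      calc ENNReal.ofReal (‖η‖ ^ (-(5 / 2 : ℝ)) * ‖ζ + η‖⁻¹)
          ≤ ENNReal.ofReal (2 / r * ‖η‖ ^ (-(5 / 2 : ℝ))) := by
            refine ENNReal.ofReal_le_ofReal ?_
            rw [mul_comm (2 / r)]
            exact mul_le_mul_of_nonneg_left hle (Real.rpow_nonneg (norm_nonneg _) _)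
        _ = (ball (0 : ℝ³) (4 * r)).indicator
              (fun η => ENNReal.ofReal (2 / r * ‖η‖ ^ (-(5 / 2 : ℝ)))) η := by
            rw [indicator_of_mem hB]
        _ ≤ _ := le_add_right (le_add_left le_rfl)
    · -- far zone
      have hB' : 4 * r ≤ ‖η‖ := by rwa [mem_ball_zero_iff, not_lt] at hB
      have hη0 : 0 < ‖η‖ := by linarith
      have h34 : 3 / 4 * ‖η‖ ≤ ‖ζ + η‖ := by
        have h1 : ‖η‖ - ‖ζ‖ ≤ ‖ζ + η‖ := by
          calc ‖η‖ - ‖ζ‖ ≤ ‖η - (-ζ)‖ := by rw [← norm_neg ζ]; exact norm_sub_norm_le η (-ζ)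
            _ = ‖ζ + η‖ := by rw [sub_neg_eq_add, add_comm]
        linarith
      have hle : ‖ζ + η‖⁻¹ ≤ 4 / 3 * ‖η‖⁻¹ := by
        rw [show 4 / 3 * ‖η‖⁻¹ = (3 / 4 * ‖η‖)⁻¹ by rw [mul_inv]; norm_num]
        exact inv_anti₀ (by positivity) h34
      have hpow : ‖η‖ ^ (-(5 / 2 : ℝ)) * ‖η‖⁻¹ = ‖η‖ ^ (-(7 / 2 : ℝ)) := by
        rw [← Real.rpow_neg_one, ← Real.rpow_add hη0]
        norm_num
      calc ENNReal.ofReal (‖η‖ ^ (-(5 / 2 : ℝ)) * ‖ζ + η‖⁻¹)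
          ≤ ENNReal.ofReal (4 / 3 * ‖η‖ ^ (-(7 / 2 : ℝ))) := by
            refine ENNReal.ofReal_le_ofReal ?_
            calc ‖η‖ ^ (-(5 / 2 : ℝ)) * ‖ζ + η‖⁻¹ ≤ ‖η‖ ^ (-(5 / 2 : ℝ)) * (4 / 3 * ‖η‖⁻¹) :=
                  mul_le_mul_of_nonneg_left hle (Real.rpow_nonneg (norm_nonneg _) _)
              _ = 4 / 3 * ‖η‖ ^ (-(7 / 2 : ℝ)) := by rw [← hpow]; ring
        _ = (ball (0 : ℝ³) (4 * r))ᶜ.indicator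
              (fun η => ENNReal.ofReal (4 / 3 * ‖η‖ ^ (-(7 / 2 : ℝ)))) η := by
            rw [indicator_of_mem (mem_compl hB)]
        _ ≤ _ := le_add_left le_rfl

/-- Translation of the near-zone integral to the origin. [folklore] -/
theorem lintegral_ball_neg_norm_add_inv (ζ : ℝ³) {ρ : ℝ} (hρ : 0 < ρ) :
    ∫⁻ η in ball (-ζ) ρ, ENNReal.ofReal ‖ζ + η‖⁻¹ =
      ENNReal.ofReal (threeVolBall * (ρ ^ 2 / 2)) := by
  rw [← lintegral_ball_norm_inv hρ, ← lintegral_indicator measurableSet_ball,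
    ← lintegral_indicator measurableSet_ball,
    ← lintegral_add_right_eq_self (μ := (volume : Measure ℝ³))
      ((ball (0 : ℝ³) ρ).indicator fun y => ENNReal.ofReal ‖y‖⁻¹) ζ]
  congr 1 with η
  simp only [indicator, mem_ball, dist_eq_norm, sub_neg_eq_add, sub_zero, add_comm ζ η]

/-- **The potential bound.** For `ζ ≠ 0`,
`∫ ‖η‖^{-5/2} ‖ζ + η‖⁻¹ dη ≤ 11 · threeVolBall · ‖ζ‖^{-1/2}` (the exact value is
`4 · threeVolBall · ‖ζ‖^{-1/2}` by Newton's shell theorem; only finiteness and the scaling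
matter). This is the row/column sum of Schur's test for the kernel `(‖ξ‖‖ξ−η‖‖η‖)⁻¹` with the
weight `‖·‖^{-3/2}`. [folklore] -/
theorem lintegral_potential_le {ζ : ℝ³} (hζ : ζ ≠ 0) :
    ∫⁻ η, ENNReal.ofReal (‖η‖ ^ (-(5 / 2 : ℝ)) * ‖ζ + η‖⁻¹) ≤
      ENNReal.ofReal (11 * threeVolBall * ‖ζ‖ ^ (-(1 / 2) : ℝ)) := by
  have hr : 0 < ‖ζ‖ := norm_pos_iff.2 hζ
  set r := ‖ζ‖ with hrdef
  have hV := threeVolBall_pos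
  -- measurability of the three majorants
  have hm1 : Measurable fun η : ℝ³ => ENNReal.ofReal ((r / 2) ^ (-(5 / 2 : ℝ)) * ‖ζ + η‖⁻¹) :=
    (measurable_const.mul ((continuous_const.add continuous_id).norm.measurable.inv)).ennreal_ofReal
  have hm2 : Measurable fun η : ℝ³ => ENNReal.ofReal (2 / r * ‖η‖ ^ (-(5 / 2 : ℝ))) :=
    (measurable_const.mul (measurable_norm.pow_const _)).ennreal_ofReal
  have hm3 : Measurable fun η : ℝ³ => ENNReal.ofReal (4 / 3 * ‖η‖ ^ (-(7 / 2 : ℝ))) :=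
    (measurable_const.mul (measurable_norm.pow_const _)).ennreal_ofReal
  calc ∫⁻ η, ENNReal.ofReal (‖η‖ ^ (-(5 / 2 : ℝ)) * ‖ζ + η‖⁻¹)
      ≤ ∫⁻ η, ((ball (-ζ) (r / 2)).indicator
            (fun η => ENNReal.ofReal ((r / 2) ^ (-(5 / 2 : ℝ)) * ‖ζ + η‖⁻¹)) η +
          (ball (0 : ℝ³) (4 * r)).indicator
            (fun η => ENNReal.ofReal (2 / r * ‖η‖ ^ (-(5 / 2 : ℝ)))) η +
          (ball (0 : ℝ³) (4 * r))ᶜ.indicator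
            (fun η => ENNReal.ofReal (4 / 3 * ‖η‖ ^ (-(7 / 2 : ℝ)))) η) :=
        lintegral_mono fun η => potential_integrand_le hζ η
    _ = (∫⁻ η in ball (-ζ) (r / 2), ENNReal.ofReal ((r / 2) ^ (-(5 / 2 : ℝ)) * ‖ζ + η‖⁻¹)) +
          (∫⁻ η in ball (0 : ℝ³) (4 * r), ENNReal.ofReal (2 / r * ‖η‖ ^ (-(5 / 2 : ℝ)))) +
          ∫⁻ η in (ball (0 : ℝ³) (4 * r))ᶜ, ENNReal.ofReal (4 / 3 * ‖η‖ ^ (-(7 / 2 : ℝ))) := by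
        rw [lintegral_add_right _ (hm3.indicator measurableSet_ball.compl),
          lintegral_add_right _ (hm2.indicator measurableSet_ball),
          lintegral_indicator measurableSet_ball, lintegral_indicator measurableSet_ball,
          lintegral_indicator measurableSet_ball.compl]
    _ = ENNReal.ofReal ((r / 2) ^ (-(5 / 2 : ℝ))) * ENNReal.ofReal (threeVolBall * ((r / 2) ^ 2 / 2)) +
          ENNReal.ofReal (2 / r) * ENNReal.ofReal (threeVolBall * (2 * (4 * r) ^ (1 / 2 : ℝ))) +
          ENNReal.ofReal (4 / 3) * ENNReal.ofReal (threeVolBall * (2 * (4 * r) ^ (-(1 / 2) : ℝ))) := by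
        have h4r : 0 < 4 * r := by positivity
        have hmA : Measurable fun η : ℝ³ => ENNReal.ofReal ‖ζ + η‖⁻¹ :=
          (continuous_const.add continuous_id).norm.measurable.inv.ennreal_ofReal
        have hmB : Measurable fun η : ℝ³ => ENNReal.ofReal (‖η‖ ^ (-(5 / 2 : ℝ))) :=
          (measurable_norm.pow_const _).ennreal_ofReal
        have hmC : Measurable fun η : ℝ³ => ENNReal.ofReal (‖η‖ ^ (-(7 / 2 : ℝ))) :=
          (measurable_norm.pow_const _).ennreal_ofReal
        have e1 : ∫⁻ η in ball (-ζ) (r / 2), ENNReal.ofReal ((r / 2) ^ (-(5 / 2 : ℝ)) * ‖ζ + η‖⁻¹) =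
            ENNReal.ofReal ((r / 2) ^ (-(5 / 2 : ℝ))) *
              ENNReal.ofReal (threeVolBall * ((r / 2) ^ 2 / 2)) := by
          rw [← lintegral_ball_neg_norm_add_inv ζ (half_pos hr), ← lintegral_const_mul _ hmA]
          exact lintegral_congr fun η => ENNReal.ofReal_mul (Real.rpow_nonneg (by positivity) _)
        have e2 : ∫⁻ η in ball (0 : ℝ³) (4 * r), ENNReal.ofReal (2 / r * ‖η‖ ^ (-(5 / 2 : ℝ))) =
            ENNReal.ofReal (2 / r) * ENNReal.ofReal (threeVolBall * (2 * (4 * r) ^ (1 / 2 : ℝ))) := by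
          rw [← lintegral_ball_norm_rpow_neg_five_halves h4r, ← lintegral_const_mul _ hmB]
          exact lintegral_congr fun η => ENNReal.ofReal_mul (by positivity)
        have e3 : ∫⁻ η in (ball (0 : ℝ³) (4 * r))ᶜ, ENNReal.ofReal (4 / 3 * ‖η‖ ^ (-(7 / 2 : ℝ))) =
            ENNReal.ofReal (4 / 3) *
              ENNReal.ofReal (threeVolBall * (2 * (4 * r) ^ (-(1 / 2) : ℝ))) := by
          rw [← lintegral_compl_ball_norm_rpow_neg_seven_halves h4r, ← lintegral_const_mul _ hmC]
          exact lintegral_congr fun η => ENNReal.ofReal_mul (by positivity)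
        rw [e1, e2, e3]
    _ = ENNReal.ofReal (threeVolBall * ((r / 2) ^ (-(5 / 2 : ℝ)) * ((r / 2) ^ 2 / 2)) +
          threeVolBall * (2 / r * (2 * (4 * r) ^ (1 / 2 : ℝ))) +
          threeVolBall * (4 / 3 * (2 * (4 * r) ^ (-(1 / 2) : ℝ)))) := by
        rw [← ENNReal.ofReal_mul (Real.rpow_nonneg (by positivity) _),
          ← ENNReal.ofReal_mul (by positivity), ← ENNReal.ofReal_mul (by positivity),
          ← ENNReal.ofReal_add (by positivity) (by positivity),
          ← ENNReal.ofReal_add (by positivity) (by positivity)]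
        congr 1
        ring
    _ ≤ ENNReal.ofReal (11 * threeVolBall * r ^ (-(1 / 2) : ℝ)) := by
        refine ENNReal.ofReal_le_ofReal ?_
        rw [rpow_aux_two hr, rpow_aux_three hr]
        have h1 := rpow_aux_one hr
        have h5 : 0 ≤ r ^ (-(1 / 2) : ℝ) := Real.rpow_nonneg hr.le _
        nlinarith [mul_le_mul_of_nonneg_left h1 hV.le]

/-! ## Schur's test for the kernel `(‖ξ‖ ‖ξ − η‖ ‖η‖)⁻¹` -/

/-- The Schur constant `J = 11 · threeVolBall`. [folklore] -/
def schurConst : ℝ := 11 * threeVolBall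

/-- `schurConst > 0`. [folklore] -/
theorem schurConst_pos : 0 < schurConst := by
  unfold schurConst; have := threeVolBall_pos; positivity

/-- The kernel `k(ξ,η) = (‖ξ‖ ‖ξ − η‖ ‖η‖)⁻¹` (real inverse: `0` on the three degenerate
hyperplanes, a null set). [folklore] -/
def schurKernel (ξ η : ℝ³) : ℝ := (‖ξ‖ * ‖ξ - η‖ * ‖η‖)⁻¹

/-- The first Schur factor `k · (‖ξ − η‖/‖η‖)^{3/2}`. [folklore] -/
def schurP (ξ η : ℝ³) : ℝ := schurKernel ξ η * (‖ξ - η‖ / ‖η‖) ^ (3 / 2 : ℝ)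

/-- The second Schur factor `k · (‖η‖/‖ξ − η‖)^{3/2}`. [folklore] -/
def schurQ (ξ η : ℝ³) : ℝ := schurKernel ξ η * (‖η‖ / ‖ξ - η‖) ^ (3 / 2 : ℝ)

/-- The kernel is nonnegative. [folklore] -/
theorem schurKernel_nonneg (ξ η : ℝ³) : 0 ≤ schurKernel ξ η := by
  unfold schurKernel; positivity

/-- The first Schur factor is nonnegative. [folklore] -/
theorem schurP_nonneg (ξ η : ℝ³) : 0 ≤ schurP ξ η := by
  unfold schurP; have := schurKernel_nonneg ξ η; positivity

/-- The second Schur factor is nonnegative. [folklore] -/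
theorem schurQ_nonneg (ξ η : ℝ³) : 0 ≤ schurQ ξ η := by
  unfold schurQ; have := schurKernel_nonneg ξ η; positivity

/-- `k = √P · √Q` pointwise (both sides vanish on the degenerate set). [folklore] -/
theorem schurKernel_eq_sqrt_mul_sqrt (ξ η : ℝ³) :
    schurKernel ξ η = Real.sqrt (schurP ξ η) * Real.sqrt (schurQ ξ η) := by
  by_cases h : ‖ξ‖ * ‖ξ - η‖ * ‖η‖ = 0
  · have hk : schurKernel ξ η = 0 := by rw [schurKernel, h, inv_zero]
    simp [schurP, hk]
  · have h1 : ‖ξ - η‖ ≠ 0 := fun h' => h (by rw [h']; ring)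
    have h2 : ‖η‖ ≠ 0 := fun h' => h (by rw [h']; ring)
    rw [← Real.sqrt_mul (schurP_nonneg ξ η)]
    have hPQ : schurP ξ η * schurQ ξ η = schurKernel ξ η ^ 2 := by
      rw [schurP, schurQ, mul_mul_mul_comm, ← Real.mul_rpow (by positivity) (by positivity),
        show ‖ξ - η‖ / ‖η‖ * (‖η‖ / ‖ξ - η‖) = 1 by field_simp, Real.one_rpow, mul_one, sq]
    rw [hPQ, Real.sqrt_sq (schurKernel_nonneg ξ η)]

/-- The first factor along the row `ξ = ζ + η`:
`P(ζ + η, η) = ‖ζ‖^{1/2} · ‖η‖^{-5/2} ‖ζ + η‖⁻¹` for `ζ ≠ 0`. [folklore] -/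
theorem schurP_add (ζ η : ℝ³) (hζ : ζ ≠ 0) :
    schurP (ζ + η) η = ‖ζ‖ ^ (1 / 2 : ℝ) * (‖η‖ ^ (-(5 / 2 : ℝ)) * ‖ζ + η‖⁻¹) := by
  have hr : 0 < ‖ζ‖ := norm_pos_iff.2 hζ
  rw [schurP, schurKernel, add_sub_cancel_right]
  by_cases hη : η = 0
  · subst hη
    simp [Real.zero_rpow (show (-(5 / 2 : ℝ)) ≠ 0 by norm_num)]
  have hs : 0 < ‖η‖ := norm_pos_iff.2 hη
  by_cases ht : ζ + η = 0
  · simp [ht]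
  have ht' : 0 < ‖ζ + η‖ := norm_pos_iff.2 ht
  have e1 : (‖ζ‖ / ‖η‖) ^ (3 / 2 : ℝ) = ‖ζ‖ * ‖ζ‖ ^ (1 / 2 : ℝ) / (‖η‖ * ‖η‖ ^ (1 / 2 : ℝ)) := by
    rw [Real.div_rpow hr.le hs.le, show (3 / 2 : ℝ) = 1 + 1 / 2 by norm_num, Real.rpow_add hr,
      Real.rpow_add hs, Real.rpow_one, Real.rpow_one]
  have e2 : ‖η‖ ^ (-(5 / 2 : ℝ)) = (‖η‖ ^ 2 * ‖η‖ ^ (1 / 2 : ℝ))⁻¹ := by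
    rw [Real.rpow_neg hs.le, show (5 / 2 : ℝ) = 2 + 1 / 2 by norm_num, Real.rpow_add hs,
      Real.rpow_two]
  have h1 : 0 < ‖η‖ ^ (1 / 2 : ℝ) := Real.rpow_pos_of_pos hs _
  have h2 : 0 < ‖ζ‖ ^ (1 / 2 : ℝ) := Real.rpow_pos_of_pos hr _
  rw [e1, e2]
  field_simp

/-- The second factor along the column `ξ = y + η`:
`Q(y + η, η) = ‖η‖^{1/2} · ‖y‖^{-5/2} ‖η + y‖⁻¹` for `η ≠ 0`. [folklore] -/
theorem schurQ_add (η y : ℝ³) (hη : η ≠ 0) :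
    schurQ (y + η) η = ‖η‖ ^ (1 / 2 : ℝ) * (‖y‖ ^ (-(5 / 2 : ℝ)) * ‖η + y‖⁻¹) := by
  have hs : 0 < ‖η‖ := norm_pos_iff.2 hη
  rw [schurQ, schurKernel, add_sub_cancel_right, add_comm y η]
  by_cases hy : y = 0
  · subst hy
    simp [Real.zero_rpow (show (-(5 / 2 : ℝ)) ≠ 0 by norm_num)]
  have hr : 0 < ‖y‖ := norm_pos_iff.2 hy
  by_cases ht : η + y = 0
  · simp [ht]
  have ht' : 0 < ‖η + y‖ := norm_pos_iff.2 ht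
  have e1 : (‖η‖ / ‖y‖) ^ (3 / 2 : ℝ) = ‖η‖ * ‖η‖ ^ (1 / 2 : ℝ) / (‖y‖ * ‖y‖ ^ (1 / 2 : ℝ)) := by
    rw [Real.div_rpow hs.le hr.le, show (3 / 2 : ℝ) = 1 + 1 / 2 by norm_num, Real.rpow_add hs,
      Real.rpow_add hr, Real.rpow_one, Real.rpow_one]
  have e2 : ‖y‖ ^ (-(5 / 2 : ℝ)) = (‖y‖ ^ 2 * ‖y‖ ^ (1 / 2 : ℝ))⁻¹ := by
    rw [Real.rpow_neg hr.le, show (5 / 2 : ℝ) = 2 + 1 / 2 by norm_num, Real.rpow_add hr,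
      Real.rpow_two]
  have h1 : 0 < ‖y‖ ^ (1 / 2 : ℝ) := Real.rpow_pos_of_pos hr _
  have h2 : 0 < ‖η‖ ^ (1 / 2 : ℝ) := Real.rpow_pos_of_pos hs _
  rw [e1, e2]
  field_simp

/-- Row sums of the first factor are bounded by the Schur constant. [folklore] -/
theorem lintegral_schurP_add_le (ζ : ℝ³) :
    ∫⁻ η, ENNReal.ofReal (schurP (ζ + η) η) ≤ ENNReal.ofReal schurConst := by
  by_cases hζ : ζ = 0
  · subst hζ
    simp [schurP, schurKernel]
  have hr : 0 < ‖ζ‖ := norm_pos_iff.2 hζ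
  calc ∫⁻ η, ENNReal.ofReal (schurP (ζ + η) η)
      = ∫⁻ η, ENNReal.ofReal (‖ζ‖ ^ (1 / 2 : ℝ)) *
          ENNReal.ofReal (‖η‖ ^ (-(5 / 2 : ℝ)) * ‖ζ + η‖⁻¹) := by
        refine lintegral_congr fun η => ?_
        rw [schurP_add ζ η hζ, ENNReal.ofReal_mul (Real.rpow_nonneg hr.le _)]
    _ = ENNReal.ofReal (‖ζ‖ ^ (1 / 2 : ℝ)) *
          ∫⁻ η, ENNReal.ofReal (‖η‖ ^ (-(5 / 2 : ℝ)) * ‖ζ + η‖⁻¹) :=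
        lintegral_const_mul _ (((measurable_norm.pow_const _).mul
          (continuous_const.add continuous_id).norm.measurable.inv).ennreal_ofReal)
    _ ≤ ENNReal.ofReal (‖ζ‖ ^ (1 / 2 : ℝ)) *
          ENNReal.ofReal (11 * threeVolBall * ‖ζ‖ ^ (-(1 / 2) : ℝ)) := by
        gcongr; exact lintegral_potential_le hζ
    _ = ENNReal.ofReal schurConst := by
        rw [← ENNReal.ofReal_mul (Real.rpow_nonneg hr.le _), schurConst]
        congr 1
        rw [show ‖ζ‖ ^ (1 / 2 : ℝ) * (11 * threeVolBall * ‖ζ‖ ^ (-(1 / 2) : ℝ)) =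
          11 * threeVolBall * (‖ζ‖ ^ (1 / 2 : ℝ) * ‖ζ‖ ^ (-(1 / 2) : ℝ)) by ring,
          ← Real.rpow_add hr]
        norm_num

/-- Column sums of the second factor are bounded by the Schur constant. [folklore] -/
theorem lintegral_schurQ_add_le (η : ℝ³) :
    ∫⁻ y, ENNReal.ofReal (schurQ (y + η) η) ≤ ENNReal.ofReal schurConst := by
  by_cases hη : η = 0
  · subst hη
    simp [schurQ, schurKernel]
  have hs : 0 < ‖η‖ := norm_pos_iff.2 hη
  calc ∫⁻ y, ENNReal.ofReal (schurQ (y + η) η)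
      = ∫⁻ y, ENNReal.ofReal (‖η‖ ^ (1 / 2 : ℝ)) *
          ENNReal.ofReal (‖y‖ ^ (-(5 / 2 : ℝ)) * ‖η + y‖⁻¹) := by
        refine lintegral_congr fun y => ?_
        rw [schurQ_add η y hη, ENNReal.ofReal_mul (Real.rpow_nonneg hs.le _)]
    _ = ENNReal.ofReal (‖η‖ ^ (1 / 2 : ℝ)) *
          ∫⁻ y, ENNReal.ofReal (‖y‖ ^ (-(5 / 2 : ℝ)) * ‖η + y‖⁻¹) :=
        lintegral_const_mul _ (((measurable_norm.pow_const _).mul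
          (continuous_const.add continuous_id).norm.measurable.inv).ennreal_ofReal)
    _ ≤ ENNReal.ofReal (‖η‖ ^ (1 / 2 : ℝ)) *
          ENNReal.ofReal (11 * threeVolBall * ‖η‖ ^ (-(1 / 2) : ℝ)) := by
        gcongr; exact lintegral_potential_le hη
    _ = ENNReal.ofReal schurConst := by
        rw [← ENNReal.ofReal_mul (Real.rpow_nonneg hs.le _), schurConst]
        congr 1
        rw [show ‖η‖ ^ (1 / 2 : ℝ) * (11 * threeVolBall * ‖η‖ ^ (-(1 / 2) : ℝ)) =
          11 * threeVolBall * (‖η‖ ^ (1 / 2 : ℝ) * ‖η‖ ^ (-(1 / 2) : ℝ)) by ring,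
          ← Real.rpow_add hs]
        norm_num

/-- Measurability of the Schur factors. [folklore] -/
theorem measurable_schurKernel : Measurable fun z : ℝ³ × ℝ³ => schurKernel z.1 z.2 := by
  unfold schurKernel
  exact ((measurable_fst.norm.mul (measurable_fst.sub measurable_snd).norm).mul
    measurable_snd.norm).inv

/-- Measurability of the first Schur factor. [folklore] -/
theorem measurable_schurP : Measurable fun z : ℝ³ × ℝ³ => schurP z.1 z.2 := by
  unfold schurP
  exact measurable_schurKernel.mul
    (((measurable_fst.sub measurable_snd).norm.div measurable_snd.norm).pow_const _)

/-- Measurability of the second Schur factor. [folklore] -/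
theorem measurable_schurQ : Measurable fun z : ℝ³ × ℝ³ => schurQ z.1 z.2 := by
  unfold schurQ
  exact measurable_schurKernel.mul
    ((measurable_snd.norm.div (measurable_fst.sub measurable_snd).norm).pow_const _)

/-- **Schur's test** for the kernel `(‖ξ‖‖ξ−η‖‖η‖)⁻¹` on `ℝ³ × ℝ³` with the weight
`‖·‖^{-3/2}`: for measurable `a, b ≥ 0`,
`∫∫ a(ξ−η) b(η) / (‖ξ‖‖ξ−η‖‖η‖) dη dξ ≤ J ‖a‖₂ ‖b‖₂`. This is the continuum form of the
Schur/Young step concluding Tao's proof of Prop. 9.1 (arXiv:1108.1165, p. 28: "the claim then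
follows from Schur's test"). [folklore] -/
theorem lintegral_lintegral_schurKernel_mul_mul_le {a b : ℝ³ → ℝ≥0∞} (ha : Measurable a)
    (hb : Measurable b) :
    ∫⁻ ξ, ∫⁻ η, ENNReal.ofReal (schurKernel ξ η) * a (ξ - η) * b η ≤
      ENNReal.ofReal schurConst * (∫⁻ ζ, a ζ ^ 2) ^ (1 / 2 : ℝ) * (∫⁻ η, b η ^ 2) ^ (1 / 2 : ℝ) := by
  -- the two Hölder factors on the product space
  set F : ℝ³ × ℝ³ → ℝ≥0∞ := fun z => ENNReal.ofReal (Real.sqrt (schurP z.1 z.2)) * a (z.1 - z.2)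
    with hF
  set G : ℝ³ × ℝ³ → ℝ≥0∞ := fun z => ENNReal.ofReal (Real.sqrt (schurQ z.1 z.2)) * b z.2 with hG
  have hFm : Measurable F :=
    (measurable_schurP.sqrt.ennreal_ofReal).mul (ha.comp (measurable_fst.sub measurable_snd))
  have hGm : Measurable G := (measurable_schurQ.sqrt.ennreal_ofReal).mul (hb.comp measurable_snd)
  have hint : ∀ ξ η, ENNReal.ofReal (schurKernel ξ η) * a (ξ - η) * b η = F (ξ, η) * G (ξ, η) := by
    intro ξ η
    simp only [hF, hG]
    rw [schurKernel_eq_sqrt_mul_sqrt, ENNReal.ofReal_mul (Real.sqrt_nonneg _)]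
    ring
  simp_rw [hint]
  rw [show (∫⁻ ξ, ∫⁻ η, F (ξ, η) * G (ξ, η)) = ∫⁻ z, F z * G z ∂(volume.prod volume) from
    (lintegral_prod (fun z => F z * G z) (hFm.mul hGm).aemeasurable).symm]
  -- Hölder
  have hH := ENNReal.lintegral_mul_le_Lp_mul_Lq (volume.prod volume) Real.HolderConjugate.two_two
    hFm.aemeasurable hGm.aemeasurable
  simp only [Pi.mul_apply] at hH
  refine hH.trans ?_
  -- the two square integrals
  have hF2 : ∫⁻ z, F z ^ (2 : ℝ) ∂(volume.prod volume) ≤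
      ENNReal.ofReal schurConst * ∫⁻ ζ, a ζ ^ 2 := by
    have h1 : ∀ z : ℝ³ × ℝ³, F z ^ (2 : ℝ) = ENNReal.ofReal (schurP z.1 z.2) * a (z.1 - z.2) ^ 2 := by
      intro z
      simp only [hF]
      rw [ENNReal.rpow_two, mul_pow, ← ENNReal.ofReal_pow (Real.sqrt_nonneg _),
        Real.sq_sqrt (schurP_nonneg _ _)]
    simp_rw [h1]
    have hm : Measurable fun z : ℝ³ × ℝ³ => ENNReal.ofReal (schurP z.1 z.2) * a (z.1 - z.2) ^ 2 :=
      (measurable_schurP.ennreal_ofReal).mul ((ha.comp (measurable_fst.sub measurable_snd)).pow_const _)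
    rw [lintegral_prod (fun z : ℝ³ × ℝ³ => ENNReal.ofReal (schurP z.1 z.2) * a (z.1 - z.2) ^ 2)
      hm.aemeasurable]
    -- substitute ξ = ζ + η in the inner integral after swapping
    rw [lintegral_lintegral_swap hm.aemeasurable]
    have h2 : ∀ η, ∫⁻ ξ, ENNReal.ofReal (schurP ξ η) * a (ξ - η) ^ 2 =
        ∫⁻ ζ, ENNReal.ofReal (schurP (ζ + η) η) * a ζ ^ 2 := by
      intro η
      rw [← lintegral_add_right_eq_self (μ := (volume : Measure ℝ³))
        (fun ξ => ENNReal.ofReal (schurP ξ η) * a (ξ - η) ^ 2) η]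
      simp only [add_sub_cancel_right]
    simp_rw [h2]
    rw [lintegral_lintegral_swap]
    · calc ∫⁻ ζ, ∫⁻ η, ENNReal.ofReal (schurP (ζ + η) η) * a ζ ^ 2
          = ∫⁻ ζ, a ζ ^ 2 * ∫⁻ η, ENNReal.ofReal (schurP (ζ + η) η) := by
            refine lintegral_congr fun ζ => ?_
            have hmζ : Measurable fun η : ℝ³ => ENNReal.ofReal (schurP (ζ + η) η) :=
              (measurable_schurP.comp ((measurable_id.const_add ζ).prodMk measurable_id)).ennreal_ofReal
            rw [← lintegral_const_mul _ hmζ]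
            exact lintegral_congr fun η => mul_comm _ _
        _ ≤ ∫⁻ ζ, a ζ ^ 2 * ENNReal.ofReal schurConst :=
            lintegral_mono fun ζ => mul_le_mul_right (lintegral_schurP_add_le ζ) _
        _ = ENNReal.ofReal schurConst * ∫⁻ ζ, a ζ ^ 2 := by
            rw [lintegral_mul_const _ (ha.pow_const _), mul_comm]
    · exact ((measurable_schurP.comp ((measurable_snd.add measurable_fst).prodMk
        measurable_fst)).ennreal_ofReal.mul ((ha.comp measurable_snd).pow_const _)).aemeasurable
  have hG2 : ∫⁻ z, G z ^ (2 : ℝ) ∂(volume.prod volume) ≤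
      ENNReal.ofReal schurConst * ∫⁻ η, b η ^ 2 := by
    have h1 : ∀ z : ℝ³ × ℝ³, G z ^ (2 : ℝ) = ENNReal.ofReal (schurQ z.1 z.2) * b z.2 ^ 2 := by
      intro z
      simp only [hG]
      rw [ENNReal.rpow_two, mul_pow, ← ENNReal.ofReal_pow (Real.sqrt_nonneg _),
        Real.sq_sqrt (schurQ_nonneg _ _)]
    simp_rw [h1]
    have hm : Measurable fun z : ℝ³ × ℝ³ => ENNReal.ofReal (schurQ z.1 z.2) * b z.2 ^ 2 :=
      (measurable_schurQ.ennreal_ofReal).mul ((hb.comp measurable_snd).pow_const _)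
    rw [lintegral_prod (fun z : ℝ³ × ℝ³ => ENNReal.ofReal (schurQ z.1 z.2) * b z.2 ^ 2)
      hm.aemeasurable, lintegral_lintegral_swap hm.aemeasurable]
    calc ∫⁻ η, ∫⁻ ξ, ENNReal.ofReal (schurQ ξ η) * b η ^ 2
        = ∫⁻ η, b η ^ 2 * ∫⁻ y, ENNReal.ofReal (schurQ (y + η) η) := by
          refine lintegral_congr fun η => ?_
          have hmη : Measurable fun ξ : ℝ³ => ENNReal.ofReal (schurQ ξ η) :=
            (measurable_schurQ.comp (measurable_id.prodMk measurable_const)).ennreal_ofReal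
          rw [lintegral_mul_const _ hmη, mul_comm,
            ← lintegral_add_right_eq_self (μ := (volume : Measure ℝ³))
              (fun ξ => ENNReal.ofReal (schurQ ξ η)) η]
      _ ≤ ∫⁻ η, b η ^ 2 * ENNReal.ofReal schurConst :=
          lintegral_mono fun η => mul_le_mul_right (lintegral_schurQ_add_le η) _
      _ = ENNReal.ofReal schurConst * ∫⁻ η, b η ^ 2 := by
          rw [lintegral_mul_const _ (hb.pow_const _), mul_comm]
  -- combine
  have hJ0 : ENNReal.ofReal schurConst ≠ 0 := (ENNReal.ofReal_pos.2 schurConst_pos).ne'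
  calc (∫⁻ z, F z ^ (2 : ℝ) ∂volume.prod volume) ^ (1 / (2 : ℝ)) *
        (∫⁻ z, G z ^ (2 : ℝ) ∂volume.prod volume) ^ (1 / (2 : ℝ))
      ≤ (ENNReal.ofReal schurConst * ∫⁻ ζ, a ζ ^ 2) ^ (1 / (2 : ℝ)) *
          (ENNReal.ofReal schurConst * ∫⁻ η, b η ^ 2) ^ (1 / (2 : ℝ)) := by
        gcongr
    _ = ENNReal.ofReal schurConst * (∫⁻ ζ, a ζ ^ 2) ^ (1 / 2 : ℝ) *
          (∫⁻ η, b η ^ 2) ^ (1 / 2 : ℝ) := by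
        rw [ENNReal.mul_rpow_of_nonneg _ _ (by norm_num : (0 : ℝ) ≤ 1 / 2),
          ENNReal.mul_rpow_of_nonneg _ _ (by norm_num : (0 : ℝ) ≤ 1 / 2)]
        rw [show ENNReal.ofReal schurConst ^ (1 / (2 : ℝ)) * (∫⁻ ζ, a ζ ^ 2) ^ (1 / (2 : ℝ)) *
            (ENNReal.ofReal schurConst ^ (1 / (2 : ℝ)) * (∫⁻ η, b η ^ 2) ^ (1 / (2 : ℝ))) =
            (ENNReal.ofReal schurConst ^ (1 / (2 : ℝ)) * ENNReal.ofReal schurConst ^ (1 / (2 : ℝ))) *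
              (∫⁻ ζ, a ζ ^ 2) ^ (1 / (2 : ℝ)) * (∫⁻ η, b η ^ 2) ^ (1 / (2 : ℝ)) by ring,
          ← ENNReal.rpow_add _ _ hJ0 ENNReal.ofReal_ne_top]
        norm_num

/-! ## The Fourier transform of a product is the convolution of the Fourier transforms -/

section ProductFormula

variable {V : Type*} [NormedAddCommGroup V] [InnerProductSpace ℝ V] [FiniteDimensional ℝ V]
  [MeasurableSpace V] [BorelSpace V]

omit [FiniteDimensional ℝ V] [MeasurableSpace V] [BorelSpace V] in
/-- Phase algebra: `𝐞(−⟪v,ξ⟫) 𝐞(⟪η,v⟫) = 𝐞(−⟪v, ξ − η⟫)`. [folklore] -/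
theorem fourierChar_neg_inner_mul_fourierChar_inner (v ξ η : V) :
    ((𝐞 (-⟪v, ξ⟫) : ℂ) * (𝐞 ⟪η, v⟫ : ℂ)) = (𝐞 (-⟪v, ξ - η⟫) : ℂ) := by
  rw [← Circle.coe_mul, ← AddChar.map_add_eq_mul]
  congr 2
  rw [inner_sub_right, real_inner_comm η v]
  ring

/-- **`𝓕(φψ) = 𝓕φ ∗ 𝓕ψ`.** For a continuous integrable `φ` with integrable Fourier transform and
an integrable `ψ`: `𝓕(φ·ψ)(ξ) = ∫ 𝓕φ(η) 𝓕ψ(ξ − η) dη` (Fourier inversion for `φ` and Fubini).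
Mathlib has the dual statement `Real.fourier_mul_convolution_eq` (`𝓕(f ∗ g) = 𝓕f · 𝓕g`). [folklore] -/
theorem fourier_mul_eq_integral {φ ψ : V → ℂ} (hφc : Continuous φ) (hφ : Integrable φ)
    (hφF : Integrable (𝓕 φ)) (hψ : Integrable ψ) (ξ : V) :
    𝓕 (fun x => φ x * ψ x) ξ = ∫ η, 𝓕 φ η * 𝓕 ψ (ξ - η) := by
  have hinv : ∀ v, φ v = ∫ η, (𝐞 ⟪η, v⟫ : ℂ) * 𝓕 φ η := by
    intro v
    have h := congrFun (hφc.fourierInv_fourier_eq hφ hφF) v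
    rw [← h, Real.fourierInv_eq]
    simp only [Circle.smul_def, smul_eq_mul]
  -- the double integrand
  set G : V → V → ℂ := fun v η => (𝐞 (-⟪v, ξ⟫) : ℂ) * (𝐞 ⟪η, v⟫ : ℂ) * 𝓕 φ η * ψ v with hG
  have hGi : Integrable (uncurry G) (volume.prod volume) := by
    have h1 : Integrable (fun z : V × V => ψ z.1 * 𝓕 φ z.2) (volume.prod volume) :=
      hψ.mul_prod hφF
    refine h1.norm.mono' ?_ (Eventually.of_forall fun z => ?_)
    · have hc1 : Continuous fun z : V × V => ((𝐞 (-⟪z.1, ξ⟫) : ℂ)) :=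
        continuous_subtype_val.comp
          (continuous_fourierChar.comp (continuous_fst.inner continuous_const).neg)
      have hc2 : Continuous fun z : V × V => ((𝐞 ⟪z.2, z.1⟫ : ℂ)) :=
        continuous_subtype_val.comp
          (continuous_fourierChar.comp (continuous_snd.inner continuous_fst))
      have hc3 : Continuous fun z : V × V => 𝓕 φ z.2 :=
        (Literature.Analysis.FunctionSpaces.continuous_fourierIntegral hφ).comp continuous_snd
      exact ((hc1.mul hc2).mul hc3).aestronglyMeasurable.mul hψ.1.comp_fst
    · simp only [uncurry, hG, norm_mul, Circle.norm_coe, one_mul, mul_comm ‖ψ z.1‖]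
      exact le_rfl
  calc 𝓕 (fun x => φ x * ψ x) ξ
      = ∫ v, (𝐞 (-⟪v, ξ⟫) : ℂ) * (φ v * ψ v) := by
        rw [Real.fourier_eq]; simp only [Circle.smul_def, smul_eq_mul]
    _ = ∫ v, ∫ η, G v η := by
        refine integral_congr_ae (Eventually.of_forall fun v => ?_)
        simp only [hG]
        rw [hinv v, ← integral_mul_const, ← integral_const_mul]
        refine integral_congr_ae (Eventually.of_forall fun η => ?_)
        simp only
        ring
    _ = ∫ η, ∫ v, G v η := integral_integral_swap hGi
    _ = ∫ η, 𝓕 φ η * 𝓕 ψ (ξ - η) := by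
        refine integral_congr_ae (Eventually.of_forall fun η => ?_)
        simp only [hG]
        rw [Real.fourier_eq ψ (ξ - η), ← integral_const_mul]
        refine integral_congr_ae (Eventually.of_forall fun v => ?_)
        simp only [Circle.smul_def, smul_eq_mul]
        rw [← fourierChar_neg_inner_mul_fourierChar_inner v ξ η]
        ring

end ProductFormula

/-! ## Plancherel with one derivative: `4π² ∫ ‖ξ‖² ‖𝓕φ‖² = ∑ᵢ ∫ ‖∂ᵢφ‖²` -/

section GradientPlancherel

open SchwartzMap LineDeriv

/-- The Fourier transform of a partial derivative of a Schwartz function on `ℝ³`: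
`𝓕(∂ᵢφ)(ξ) = 2πi ξᵢ 𝓕φ(ξ)`. [folklore] -/
theorem fourier_lineDeriv_single_apply (φ : 𝓢(ℝ³, ℂ)) (i : Fin 3) (ξ : ℝ³) :
    𝓕 (⇑(∂_{EuclideanSpace.single i (1 : ℝ)} φ : 𝓢(ℝ³, ℂ))) ξ =
      (2 * π * Complex.I) * ((ξ i : ℝ) : ℂ) * 𝓕 (⇑φ) ξ := by
  have h := DFunLike.congr_fun (fourier_lineDerivOp_eq φ (EuclideanSpace.single i (1 : ℝ))) ξ
  have hg : (fun x : ℝ³ => inner ℝ x (EuclideanSpace.single i (1 : ℝ))).HasTemperateGrowth :=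
    ((innerSL ℝ).flip (EuclideanSpace.single i (1 : ℝ))).hasTemperateGrowth
  rw [smul_apply, smulLeftCLM_apply_apply hg] at h
  rw [← fourier_coe, ← fourier_coe, h, EuclideanSpace.inner_single_right]
  simp only [conj_trivial, one_mul, Complex.real_smul, smul_eq_mul]
  ring

/-- Pointwise: `∑ᵢ ‖𝓕(∂ᵢφ)(ξ)‖ₑ² = (2π‖ξ‖)² ‖𝓕φ(ξ)‖ₑ²`. [folklore] -/
theorem sum_enorm_fourier_lineDeriv_sq (φ : 𝓢(ℝ³, ℂ)) (ξ : ℝ³) :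
    ∑ i : Fin 3, ‖𝓕 (⇑(∂_{EuclideanSpace.single i (1 : ℝ)} φ : 𝓢(ℝ³, ℂ))) ξ‖ₑ ^ 2 =
      ENNReal.ofReal ((2 * π * ‖ξ‖) ^ 2) * ‖𝓕 (⇑φ) ξ‖ₑ ^ 2 := by
  have h1 : ∀ i : Fin 3, ‖𝓕 (⇑(∂_{EuclideanSpace.single i (1 : ℝ)} φ : 𝓢(ℝ³, ℂ))) ξ‖ₑ ^ 2 =
      ENNReal.ofReal ((2 * π) ^ 2 * (ξ i) ^ 2) * ‖𝓕 (⇑φ) ξ‖ₑ ^ 2 := by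
    intro i
    rw [fourier_lineDeriv_single_apply, enorm_mul, enorm_mul, mul_pow, mul_pow,
      ← ofReal_norm, ← ofReal_norm, ← ENNReal.ofReal_pow (norm_nonneg _),
      ← ENNReal.ofReal_pow (norm_nonneg _), ← ENNReal.ofReal_mul (by positivity)]
    congr 2
    rw [Complex.norm_real, Real.norm_eq_abs, sq_abs]
    simp [Complex.norm_I, abs_of_pos Real.pi_pos]
  simp_rw [h1]
  rw [← Finset.sum_mul, ← ENNReal.ofReal_sum_of_nonneg (fun i _ => by positivity),
    ← Finset.mul_sum, ← EuclideanSpace.real_norm_sq_eq]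
  congr 2
  ring

/-- **Plancherel with one derivative** for Schwartz functions on `ℝ³`:
`∫ (2π‖ξ‖)² ‖𝓕φ(ξ)‖² dξ = ∑ᵢ ∫ ‖∂ᵢφ‖²` (as Lebesgue integrals). [folklore] -/
theorem lintegral_norm_sq_mul_enorm_fourier_sq (φ : 𝓢(ℝ³, ℂ)) :
    ∫⁻ ξ, ENNReal.ofReal ((2 * π * ‖ξ‖) ^ 2) * ‖𝓕 (⇑φ) ξ‖ₑ ^ 2 =
      ∑ i : Fin 3, ∫⁻ x, ‖fderiv ℝ (⇑φ) x (EuclideanSpace.single i (1 : ℝ))‖ₑ ^ 2 := by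
  have h1 : ∀ i : Fin 3, ∫⁻ x, ‖fderiv ℝ (⇑φ) x (EuclideanSpace.single i (1 : ℝ))‖ₑ ^ 2 =
      ∫⁻ ξ, ‖𝓕 (⇑(∂_{EuclideanSpace.single i (1 : ℝ)} φ : 𝓢(ℝ³, ℂ))) ξ‖ₑ ^ 2 := by
    intro i
    rw [Literature.Analysis.FunctionSpaces.lintegral_enorm_sq_fourierIntegral_eq
      (∂_{EuclideanSpace.single i (1 : ℝ)} φ : 𝓢(ℝ³, ℂ)).integrable
      ((∂_{EuclideanSpace.single i (1 : ℝ)} φ : 𝓢(ℝ³, ℂ)).memLp 2)]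
    refine lintegral_congr fun x => ?_
    rw [lineDerivOp_apply_eq_fderiv]
  simp_rw [h1, ← sum_enorm_fourier_lineDeriv_sq]
  rw [lintegral_finsetSum]
  intro i _
  exact (Literature.Analysis.FunctionSpaces.continuous_fourierIntegral
    (∂_{EuclideanSpace.single i (1 : ℝ)} φ : 𝓢(ℝ³, ℂ)).integrable).measurable.enorm.pow_const _

end GradientPlancherel

/-! ## The bilinear estimate for Schwartz functions -/

section SchwartzEstimate

open SchwartzMap

/-- The `Ḣ¹`-type quantity `∑ᵢ ∫ ‖∂ᵢφ‖²` of a function on `ℝ³` (as a Lebesgue integral). [folklore] -/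
def gradEnergy (f : ℝ³ → ℂ) : ℝ≥0∞ :=
  ∑ i : Fin 3, ∫⁻ x, ‖fderiv ℝ f x (EuclideanSpace.single i (1 : ℝ))‖ₑ ^ 2

/-- Unfolding `gradEnergy`. [folklore] -/
theorem gradEnergy_def (f : ℝ³ → ℂ) :
    gradEnergy f = ∑ i : Fin 3, ∫⁻ x, ‖fderiv ℝ f x (EuclideanSpace.single i (1 : ℝ))‖ₑ ^ 2 :=
  rfl

/-- The Schur weight function `a(ζ) = ‖ζ‖ ‖𝓕φ(ζ)‖` has `∫ a² = gradEnergy φ / (2π)²`. [folklore] -/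
theorem lintegral_enorm_mul_fourier_sq (φ : 𝓢(ℝ³, ℂ)) :
    ∫⁻ ζ, (‖ζ‖ₑ * ‖𝓕 (⇑φ) ζ‖ₑ) ^ 2 = (ENNReal.ofReal ((2 * π) ^ 2))⁻¹ * gradEnergy (⇑φ) := by
  have h2π : ENNReal.ofReal ((2 * π) ^ 2) ≠ 0 := (ENNReal.ofReal_pos.2 (by positivity)).ne'
  rw [gradEnergy, ← lintegral_norm_sq_mul_enorm_fourier_sq φ, ← lintegral_const_mul']
  · refine lintegral_congr fun ζ => ?_
    rw [mul_pow, show (2 * π * ‖ζ‖) ^ 2 = (2 * π) ^ 2 * ‖ζ‖ ^ 2 by ring,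
      ENNReal.ofReal_mul (by positivity), ← mul_assoc, ← mul_assoc,
      ENNReal.inv_mul_cancel h2π ENNReal.ofReal_ne_top, one_mul,
      ENNReal.ofReal_pow (norm_nonneg _), ofReal_norm]
  · exact ENNReal.inv_ne_top.2 h2π

/-- Pointwise reduction to the Schur kernel: for `ξ ≠ 0` and `η ∉ {0, ξ}`,
`‖ξ‖⁻¹ ‖𝓕φ(η)‖ ‖𝓕ψ(ξ−η)‖ = k(ξ,η) · (‖ξ−η‖ ‖𝓕ψ(ξ−η)‖) · (‖η‖ ‖𝓕φ(η)‖)`. [folklore] -/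
theorem inv_enorm_mul_eq_schurKernel {ξ η : ℝ³} (hξ : ξ ≠ 0) (hη : η ≠ 0) (hηξ : η ≠ ξ)
    (A B : ℝ≥0∞) :
    ‖ξ‖ₑ⁻¹ * (B * A) =
      ENNReal.ofReal (schurKernel ξ η) * (‖ξ - η‖ₑ * A) * (‖η‖ₑ * B) := by
  have h1 : 0 < ‖ξ‖ := norm_pos_iff.2 hξ
  have h2 : 0 < ‖η‖ := norm_pos_iff.2 hη
  have h3 : 0 < ‖ξ - η‖ := norm_pos_iff.2 (sub_ne_zero.2 (Ne.symm hηξ))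
  have hk : ENNReal.ofReal (schurKernel ξ η) * ‖ξ - η‖ₑ * ‖η‖ₑ = ‖ξ‖ₑ⁻¹ := by
    rw [← ofReal_norm, ← ofReal_norm, ← ofReal_norm,
      ← ENNReal.ofReal_mul (schurKernel_nonneg _ _), ← ENNReal.ofReal_mul (by
        have := schurKernel_nonneg ξ η; positivity), ← ENNReal.ofReal_inv_of_pos h1]
    congr 1
    rw [schurKernel]
    field_simp
  rw [← hk]
  ring

/-- **The bilinear Fourier–Lebesgue estimate for Schwartz functions on `ℝ³`.**
`∫ ‖ξ‖⁻¹ |𝓕(φψ)(ξ)| dξ ≤ J (2π)⁻² (∑ᵢ‖∂ᵢφ‖₂²)^{1/2} (∑ᵢ‖∂ᵢψ‖₂²)^{1/2}`: the continuum form of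
Tao's estimate `∑_N N⁻¹ ‖P_N O(uu)‖_{L^∞} ≲ ∑ a_{N₁} a_{N₂} …` (arXiv:1108.1165, (9.7) and the
display after it), via `𝓕(φψ) = 𝓕φ ∗ 𝓕ψ` and Schur's test. [folklore] -/
theorem lintegral_inv_norm_enorm_fourier_mul_le_schwartz (φ ψ : 𝓢(ℝ³, ℂ)) :
    ∫⁻ ξ, ‖ξ‖ₑ⁻¹ * ‖𝓕 (fun x => φ x * ψ x) ξ‖ₑ ≤
      ENNReal.ofReal (schurConst / (2 * π) ^ 2) *
        gradEnergy (⇑ψ) ^ (1 / 2 : ℝ) * gradEnergy (⇑φ) ^ (1 / 2 : ℝ) := by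
  -- the Schur weight functions
  set a : ℝ³ → ℝ≥0∞ := fun ζ => ‖ζ‖ₑ * ‖𝓕 (⇑ψ) ζ‖ₑ with ha
  set b : ℝ³ → ℝ≥0∞ := fun η => ‖η‖ₑ * ‖𝓕 (⇑φ) η‖ₑ with hb
  have hψc : Continuous (𝓕 (⇑ψ)) := Literature.Analysis.FunctionSpaces.continuous_fourierIntegral ψ.integrable
  have hφc : Continuous (𝓕 (⇑φ)) := Literature.Analysis.FunctionSpaces.continuous_fourierIntegral φ.integrable
  have ham : Measurable a := measurable_id.enorm.mul hψc.measurable.enorm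
  have hbm : Measurable b := measurable_id.enorm.mul hφc.measurable.enorm
  -- Step 1: pointwise reduction for `ξ ≠ 0`
  have hstep : ∀ ξ : ℝ³, ξ ≠ 0 →
      ‖ξ‖ₑ⁻¹ * ‖𝓕 (fun x => φ x * ψ x) ξ‖ₑ ≤
        ∫⁻ η, ENNReal.ofReal (schurKernel ξ η) * a (ξ - η) * b η := by
    intro ξ hξ
    have hF : 𝓕 (fun x => φ x * ψ x) ξ = ∫ η, 𝓕 (⇑φ) η * 𝓕 (⇑ψ) (ξ - η) :=
      fourier_mul_eq_integral φ.continuous φ.integrable (𝓕 φ).integrable ψ.integrable ξ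
    have hne : ‖ξ‖ₑ⁻¹ ≠ ∞ := ENNReal.inv_ne_top.2 (by simpa [enorm_eq_nnnorm] using hξ)
    calc ‖ξ‖ₑ⁻¹ * ‖𝓕 (fun x => φ x * ψ x) ξ‖ₑ
        ≤ ‖ξ‖ₑ⁻¹ * ∫⁻ η, ‖𝓕 (⇑φ) η * 𝓕 (⇑ψ) (ξ - η)‖ₑ := by
          rw [hF]; gcongr; exact enorm_integral_le_lintegral_enorm _
      _ = ∫⁻ η, ‖ξ‖ₑ⁻¹ * (‖𝓕 (⇑φ) η‖ₑ * ‖𝓕 (⇑ψ) (ξ - η)‖ₑ) := by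
          rw [← lintegral_const_mul' _ _ hne]
          simp_rw [enorm_mul]
      _ = ∫⁻ η, ENNReal.ofReal (schurKernel ξ η) * a (ξ - η) * b η := by
          refine lintegral_congr_ae ?_
          filter_upwards [(((countable_singleton ξ).insert (0 : ℝ³)) :
            ({0, ξ} : Set ℝ³).Countable).ae_notMem volume] with η hη
          simp only [mem_insert_iff, mem_singleton_iff, not_or] at hη
          simp only [ha, hb]
          exact inv_enorm_mul_eq_schurKernel hξ hη.1 hη.2 _ _
  -- Step 2: integrate and apply Schur's test
  have hξ0 : ∀ᵐ ξ : ℝ³, ξ ≠ 0 := by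
    filter_upwards [(countable_singleton (0 : ℝ³)).ae_notMem volume] with ξ hξ
    simpa using hξ
  calc ∫⁻ ξ, ‖ξ‖ₑ⁻¹ * ‖𝓕 (fun x => φ x * ψ x) ξ‖ₑ
      ≤ ∫⁻ ξ, ∫⁻ η, ENNReal.ofReal (schurKernel ξ η) * a (ξ - η) * b η :=
        lintegral_mono_ae (hξ0.mono fun ξ hξ => hstep ξ hξ)
    _ ≤ ENNReal.ofReal schurConst * (∫⁻ ζ, a ζ ^ 2) ^ (1 / 2 : ℝ) * (∫⁻ η, b η ^ 2) ^ (1 / 2 : ℝ) :=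
        lintegral_lintegral_schurKernel_mul_mul_le ham hbm
    _ = ENNReal.ofReal (schurConst / (2 * π) ^ 2) *
          gradEnergy (⇑ψ) ^ (1 / 2 : ℝ) * gradEnergy (⇑φ) ^ (1 / 2 : ℝ) := by
        simp only [ha, hb]
        rw [lintegral_enorm_mul_fourier_sq ψ, lintegral_enorm_mul_fourier_sq φ,
          ENNReal.mul_rpow_of_nonneg _ _ (by norm_num : (0 : ℝ) ≤ 1 / 2),
          ENNReal.mul_rpow_of_nonneg _ _ (by norm_num : (0 : ℝ) ≤ 1 / 2)]
        have h2π : (0 : ℝ) < (2 * π) ^ 2 := by positivity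
        have hc : (ENNReal.ofReal ((2 * π) ^ 2))⁻¹ ^ (1 / 2 : ℝ) * (ENNReal.ofReal ((2 * π) ^ 2))⁻¹ ^ (1 / 2 : ℝ)
            = (ENNReal.ofReal ((2 * π) ^ 2))⁻¹ := by
          rw [← ENNReal.rpow_add _ _ (ENNReal.inv_ne_zero.2 ENNReal.ofReal_ne_top)
            (ENNReal.inv_ne_top.2 (ENNReal.ofReal_pos.2 h2π).ne')]
          norm_num
        calc ENNReal.ofReal schurConst *
              ((ENNReal.ofReal ((2 * π) ^ 2))⁻¹ ^ (1 / 2 : ℝ) * gradEnergy (⇑ψ) ^ (1 / 2 : ℝ)) *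
              ((ENNReal.ofReal ((2 * π) ^ 2))⁻¹ ^ (1 / 2 : ℝ) * gradEnergy (⇑φ) ^ (1 / 2 : ℝ))
            = ENNReal.ofReal schurConst *
                ((ENNReal.ofReal ((2 * π) ^ 2))⁻¹ ^ (1 / 2 : ℝ) *
                  (ENNReal.ofReal ((2 * π) ^ 2))⁻¹ ^ (1 / 2 : ℝ)) *
                gradEnergy (⇑ψ) ^ (1 / 2 : ℝ) * gradEnergy (⇑φ) ^ (1 / 2 : ℝ) := by ring
          _ = _ := by
            rw [hc, ← ENNReal.ofReal_inv_of_pos h2π, ← ENNReal.ofReal_mul schurConst_pos.le,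
              div_eq_mul_inv]
            ring_nf

end SchwartzEstimate

/-! ## From Schwartz functions to smooth `L²` functions with square-integrable gradient -/

section RealFunctions

/-- For a linear functional on `ℝ³`, `‖L‖² = ∑ᵢ L(eᵢ)²`. [folklore] -/
theorem norm_sq_eq_sum_sq_apply_single (L : ℝ³ →L[ℝ] ℝ) :
    ‖L‖ ^ 2 = ∑ i : Fin 3, (L (EuclideanSpace.single i (1 : ℝ))) ^ 2 := by
  set v : ℝ³ := (InnerProductSpace.toDual ℝ ℝ³).symm L with hv
  have hL : ∀ w, L w = ⟪v, w⟫ := fun w => by rw [hv, InnerProductSpace.toDual_symm_apply]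
  have hn : ‖L‖ = ‖v‖ := by rw [hv, LinearIsometryEquiv.norm_map]
  rw [hn, EuclideanSpace.real_norm_sq_eq]
  refine Finset.sum_congr rfl fun i _ => ?_
  rw [hL, EuclideanSpace.inner_single_right]
  simp

/-- The derivative of the complexification of a real function. [folklore] -/
theorem fderiv_ofReal_comp_apply {h : ℝ³ → ℝ} {x : ℝ³} (hh : DifferentiableAt ℝ h x) (v : ℝ³) :
    fderiv ℝ (fun y => ((h y : ℝ) : ℂ)) x v = ((fderiv ℝ h x v : ℝ) : ℂ) := by
  have h1 : HasFDerivAt (fun y => ((h y : ℝ) : ℂ)) (Complex.ofRealCLM.comp (fderiv ℝ h x)) x :=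
    Complex.ofRealCLM.hasFDerivAt.comp x hh.hasFDerivAt
  rw [h1.fderiv]
  rfl

/-- Pointwise: `∑ᵢ ‖∂ᵢ h^ℂ(x)‖ₑ² = ‖Dh(x)‖ₑ²` for a real function `h`. [folklore] -/
theorem sum_enorm_fderiv_ofReal_sq {h : ℝ³ → ℝ} {x : ℝ³} (hh : DifferentiableAt ℝ h x) :
    ∑ i : Fin 3, ‖fderiv ℝ (fun y => ((h y : ℝ) : ℂ)) x (EuclideanSpace.single i (1 : ℝ))‖ₑ ^ 2 =
      ‖fderiv ℝ h x‖ₑ ^ 2 := by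
  simp_rw [fderiv_ofReal_comp_apply hh]
  rw [← ofReal_norm, ← ENNReal.ofReal_pow (norm_nonneg _), norm_sq_eq_sum_sq_apply_single,
    ENNReal.ofReal_sum_of_nonneg (fun i _ => sq_nonneg _)]
  refine Finset.sum_congr rfl fun i _ => ?_
  rw [← ofReal_norm, ← ENNReal.ofReal_pow (norm_nonneg _), Complex.norm_real, Real.norm_eq_abs,
    sq_abs]

/-- `gradEnergy h^ℂ = ∫ ‖Dh‖²` for a differentiable real function `h`. [folklore] -/
theorem gradEnergy_ofReal_comp {h : ℝ³ → ℝ} (hh : Differentiable ℝ h) :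
    gradEnergy (fun y => ((h y : ℝ) : ℂ)) = ∫⁻ x, ‖fderiv ℝ h x‖ₑ ^ 2 := by
  rw [gradEnergy, ← lintegral_finsetSum]
  · exact lintegral_congr fun x => sum_enorm_fderiv_ofReal_sq (hh x)
  · intro i _
    exact (measurable_fderiv_apply_const ℝ _ _).enorm.pow_const _

end RealFunctions

/-! ## The main estimate -/

section MainEstimate

open SchwartzMap

/-- The complexified truncation `x ↦ χ_R(x) h(x)` of a real function. [folklore] -/
def truncC (h : ℝ³ → ℝ) (R : ℝ) : ℝ³ → ℂ := fun x => ((FluidPDE.cutoff R x * h x : ℝ) : ℂ)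

/-- Unfolding `truncC`. [folklore] -/
theorem truncC_apply (h : ℝ³ → ℝ) (R : ℝ) (x : ℝ³) :
    truncC h R x = ((FluidPDE.cutoff R x * h x : ℝ) : ℂ) := rfl

/-- The truncation has compact support (`R > 0`). [folklore] -/
theorem hasCompactSupport_truncC (h : ℝ³ → ℝ) {R : ℝ} (hR : 0 < R) :
    HasCompactSupport (truncC h R) :=
  ((FluidPDE.hasCompactSupport_cutoff hR).mul_right (f' := h)).comp_left Complex.ofReal_zero

/-- The truncation of a smooth function is smooth. [folklore] -/
theorem contDiff_truncC {h : ℝ³ → ℝ} (hh : ContDiff ℝ ((⊤ : ℕ∞) : WithTop ℕ∞) h) (R : ℝ) : ContDiff ℝ ((⊤ : ℕ∞) : WithTop ℕ∞) (truncC h R) :=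
  Complex.ofRealCLM.contDiff.comp ((FluidPDE.contDiff_cutoff R).mul hh)

/-- The truncation as a Schwartz function. [folklore] -/
def truncS {h : ℝ³ → ℝ} (hh : ContDiff ℝ ((⊤ : ℕ∞) : WithTop ℕ∞) h) {R : ℝ} (hR : 0 < R) : 𝓢(ℝ³, ℂ) :=
  (hasCompactSupport_truncC h hR).toSchwartzMap (contDiff_truncC hh R)

/-- Unfolding `truncS` at a point. [folklore] -/
theorem truncS_apply {h : ℝ³ → ℝ} (hh : ContDiff ℝ ((⊤ : ℕ∞) : WithTop ℕ∞) h) {R : ℝ} (hR : 0 < R) (x : ℝ³) :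
    truncS hh hR x = ((FluidPDE.cutoff R x * h x : ℝ) : ℂ) := rfl

/-- The underlying function of `truncS`. [folklore] -/
theorem coe_truncS {h : ℝ³ → ℝ} (hh : ContDiff ℝ ((⊤ : ℕ∞) : WithTop ℕ∞) h) {R : ℝ} (hR : 0 < R) :
    ⇑(truncS hh hR) = fun x => (((fun y => FluidPDE.cutoff R y * h y) x : ℝ) : ℂ) := rfl

/-- `gradEnergy (χ_R h)^{1/2} ≤ ‖Dh‖₂ + (C/R)‖h‖₂`. [folklore] -/
theorem gradEnergy_truncS_rpow_half_le {h : ℝ³ → ℝ} (hh : ContDiff ℝ ((⊤ : ℕ∞) : WithTop ℕ∞) h) {C R : ℝ} (hC0 : 0 ≤ C)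
    (hR : 0 < R) (hC : ∀ x : ℝ³, ‖fderiv ℝ (FluidPDE.cutoff R) x‖ ≤ C / R) :
    gradEnergy (⇑(truncS hh hR)) ^ (1 / 2 : ℝ) ≤
      eLpNorm (fderiv ℝ h) 2 volume + ENNReal.ofReal (C / R) * eLpNorm h 2 volume := by
  have hh1 : ContDiff ℝ 1 h := hh.of_le (mod_cast le_top)
  have hd : Differentiable ℝ fun y => FluidPDE.cutoff R y * h y :=
    ((FluidPDE.contDiff_cutoff (n := 1) R).mul hh1).differentiable one_ne_zero
  rw [coe_truncS, gradEnergy_ofReal_comp hd, ← FluidPDE.eLpNorm_two_eq_rpow]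
  exact FluidPDE.eLpNorm_fderiv_cutoff_smul_le volume hh1 hC0 hR hC (p := 2) (by norm_num)

/-- Pointwise convergence of the Fourier transforms of the truncated products. [folklore] -/
theorem tendsto_fourier_truncS_mul {f g : ℝ³ → ℝ} (hf : ContDiff ℝ ((⊤ : ℕ∞) : WithTop ℕ∞) f) (hg : ContDiff ℝ ((⊤ : ℕ∞) : WithTop ℕ∞) g)
    (hf2 : MemLp f 2 volume) (hg2 : MemLp g 2 volume) (ξ : ℝ³) :
    Tendsto (fun n : ℕ => 𝓕 (fun x => truncS hf (show (0 : ℝ) < n + 1 by positivity) x *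
        truncS hg (show (0 : ℝ) < n + 1 by positivity) x) ξ) atTop
      (𝓝 (𝓕 (fun x => ((f x * g x : ℝ) : ℂ)) ξ)) := by
  simp only [Real.fourier_eq, truncS_apply]
  refine tendsto_integral_of_dominated_convergence (fun x => ‖(f * g) x‖) (fun n => ?_) ?_
    (fun n => Eventually.of_forall fun x => ?_) (Eventually.of_forall fun x => ?_)
  · refine (Continuous.aestronglyMeasurable ?_)
    refine ((continuous_fourierChar.comp (continuous_id.inner continuous_const).neg).smul ?_)
    exact (Complex.continuous_ofReal.comp ((FluidPDE.contDiff_cutoff (n := 0) _).continuous.mul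
      hf.continuous)).mul (Complex.continuous_ofReal.comp
        ((FluidPDE.contDiff_cutoff (n := 0) _).continuous.mul hg.continuous))
  · exact (hf2.integrable_mul hg2).norm
  · rw [Circle.norm_smul, norm_mul, Complex.norm_real, Complex.norm_real]
    simp only [Pi.mul_apply, Real.norm_eq_abs, abs_mul]
    have h1 := FluidPDE.abs_cutoff_le_one ((n : ℝ) + 1) x
    have h2 : 0 ≤ |FluidPDE.cutoff ((n : ℝ) + 1) x| := abs_nonneg _
    calc |FluidPDE.cutoff ((n : ℝ) + 1) x| * |f x| * (|FluidPDE.cutoff ((n : ℝ) + 1) x| * |g x|)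
        ≤ 1 * |f x| * (1 * |g x|) := by gcongr
      _ = |f x| * |g x| := by ring
  · have hχ := FluidPDE.tendsto_cutoff_natCast_add_one (E := ℝ³) x
    have h1 : Tendsto (fun n : ℕ => ((FluidPDE.cutoff ((n : ℝ) + 1) x * f x : ℝ) : ℂ) *
        ((FluidPDE.cutoff ((n : ℝ) + 1) x * g x : ℝ) : ℂ)) atTop
        (𝓝 (((1 * f x : ℝ) : ℂ) * ((1 * g x : ℝ) : ℂ))) :=
      ((Complex.continuous_ofReal.tendsto _).comp (hχ.mul tendsto_const_nhds)).mul
        ((Complex.continuous_ofReal.tendsto _).comp (hχ.mul tendsto_const_nhds))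
    simp only [one_mul] at h1
    simpa [Complex.ofReal_mul] using h1.const_smul (𝐞 (-⟪x, ξ⟫))

/-- **The bilinear Fourier–Lebesgue estimate on `ℝ³`.** For smooth real `f, g ∈ L²(ℝ³)` with
square-integrable gradients,
`∫ ‖ξ‖⁻¹ |𝓕(fg)(ξ)| dξ ≤ (J/(2π)²) ‖∇g‖_{L²} ‖∇f‖_{L²}` (`J = schurConst`): `𝓕(fg) = 𝓕f ∗ 𝓕g`,
Schur's test for the kernel `(‖ξ‖‖ξ−η‖‖η‖)⁻¹` with weight `‖·‖^{-3/2}`, Plancherel, and truncation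
with Fatou's lemma to remove the Schwartz hypothesis. This is the single estimate behind the
nonlinear part (9.7) of Tao's proof of Prop. 9.1 (arXiv:1108.1165, p. 28), whose dyadic
Bernstein/paraproduct/Schur computation discretises it. [folklore] -/
theorem lintegral_inv_norm_enorm_fourier_mul_le {f g : ℝ³ → ℝ} (hf : ContDiff ℝ ((⊤ : ℕ∞) : WithTop ℕ∞) f)
    (hg : ContDiff ℝ ((⊤ : ℕ∞) : WithTop ℕ∞) g) (hf2 : MemLp f 2 volume) (hg2 : MemLp g 2 volume)
    (hdf : eLpNorm (fderiv ℝ f) 2 volume < ∞) (hdg : eLpNorm (fderiv ℝ g) 2 volume < ∞) :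
    ∫⁻ ξ, ‖ξ‖ₑ⁻¹ * ‖𝓕 (fun x => ((f x * g x : ℝ) : ℂ)) ξ‖ₑ ≤
      ENNReal.ofReal (schurConst / (2 * π) ^ 2) *
        eLpNorm (fderiv ℝ g) 2 volume * eLpNorm (fderiv ℝ f) 2 volume := by
  obtain ⟨C, hC0, hC⟩ := FluidPDE.exists_norm_fderiv_cutoff_le (E := ℝ³)
  set c := ENNReal.ofReal (schurConst / (2 * π) ^ 2) with hc
  have hR : ∀ n : ℕ, (0 : ℝ) < n + 1 := fun n => by positivity
  -- the truncations and the bounds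
  set Φ : ℕ → 𝓢(ℝ³, ℂ) := fun n => truncS hf (hR n) with hΦ
  set Ψ : ℕ → 𝓢(ℝ³, ℂ) := fun n => truncS hg (hR n) with hΨ
  set Sf := eLpNorm (fderiv ℝ f) 2 volume with hSf
  set Sg := eLpNorm (fderiv ℝ g) 2 volume with hSg
  set Bf : ℕ → ℝ≥0∞ := fun n => Sf + ENNReal.ofReal (C / ((n : ℝ) + 1)) * eLpNorm f 2 volume
    with hBf
  set Bg : ℕ → ℝ≥0∞ := fun n => Sg + ENNReal.ofReal (C / ((n : ℝ) + 1)) * eLpNorm g 2 volume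
    with hBg
  have hA : ∀ n, ∫⁻ ξ, ‖ξ‖ₑ⁻¹ * ‖𝓕 (fun x => Φ n x * Ψ n x) ξ‖ₑ ≤ c * Bg n * Bf n := by
    intro n
    refine (lintegral_inv_norm_enorm_fourier_mul_le_schwartz (Φ n) (Ψ n)).trans ?_
    gcongr
    · exact gradEnergy_truncS_rpow_half_le hg hC0 (hR n) (hC _ (hR n))
    · exact gradEnergy_truncS_rpow_half_le hf hC0 (hR n) (hC _ (hR n))
  -- limits of the bounds
  have hcoef : Tendsto (fun n : ℕ => ENNReal.ofReal (C / ((n : ℝ) + 1))) atTop (𝓝 0) := by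
    rw [← ENNReal.ofReal_zero]
    exact ENNReal.tendsto_ofReal (tendsto_const_nhds.div_atTop
      (tendsto_natCast_atTop_atTop.atTop_add tendsto_const_nhds))
  have hBfl : Tendsto Bf atTop (𝓝 Sf) := by
    have h := (tendsto_const_nhds (x := Sf)).add
      (ENNReal.Tendsto.mul_const hcoef (Or.inr hf2.eLpNorm_ne_top))
    simpa [zero_mul, add_zero] using h
  have hBgl : Tendsto Bg atTop (𝓝 Sg) := by
    have h := (tendsto_const_nhds (x := Sg)).add
      (ENNReal.Tendsto.mul_const hcoef (Or.inr hg2.eLpNorm_ne_top))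
    simpa [zero_mul, add_zero] using h
  have hlim : Tendsto (fun n => c * Bg n * Bf n) atTop (𝓝 (c * Sg * Sf)) :=
    ENNReal.Tendsto.mul (ENNReal.Tendsto.const_mul hBgl (Or.inr ENNReal.ofReal_ne_top))
      (Or.inr hdf.ne) hBfl (Or.inr (ENNReal.mul_ne_top ENNReal.ofReal_ne_top hdg.ne))
  -- Fatou
  have hmeas : ∀ n, Measurable fun ξ : ℝ³ => ‖ξ‖ₑ⁻¹ * ‖𝓕 (fun x => Φ n x * Ψ n x) ξ‖ₑ := by
    intro n
    have hi : Integrable (fun x => Φ n x * Ψ n x) :=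
      ((Φ n).memLp 2).integrable_mul ((Ψ n).memLp 2)
    exact measurable_id.enorm.inv.mul (Literature.Analysis.FunctionSpaces.continuous_fourierIntegral hi).measurable.enorm
  have hξ0 : ∀ᵐ ξ : ℝ³, ξ ≠ 0 := by
    filter_upwards [(countable_singleton (0 : ℝ³)).ae_notMem volume] with ξ hξ
    simpa using hξ
  have hptw : ∀ ξ : ℝ³, ξ ≠ 0 → Tendsto (fun n => ‖ξ‖ₑ⁻¹ * ‖𝓕 (fun x => Φ n x * Ψ n x) ξ‖ₑ)
      atTop (𝓝 (‖ξ‖ₑ⁻¹ * ‖𝓕 (fun x => ((f x * g x : ℝ) : ℂ)) ξ‖ₑ)) := by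
    intro ξ hξ
    have hne : ‖ξ‖ₑ⁻¹ ≠ ∞ := ENNReal.inv_ne_top.2 (by simpa [enorm_eq_nnnorm] using hξ)
    exact ENNReal.Tendsto.const_mul (tendsto_fourier_truncS_mul hf hg hf2 hg2 ξ).enorm
      (Or.inr hne)
  calc ∫⁻ ξ, ‖ξ‖ₑ⁻¹ * ‖𝓕 (fun x => ((f x * g x : ℝ) : ℂ)) ξ‖ₑ
      = ∫⁻ ξ, liminf (fun n => ‖ξ‖ₑ⁻¹ * ‖𝓕 (fun x => Φ n x * Ψ n x) ξ‖ₑ) atTop :=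
        lintegral_congr_ae (hξ0.mono fun ξ hξ => ((hptw ξ hξ).liminf_eq).symm)
    _ ≤ liminf (fun n => ∫⁻ ξ, ‖ξ‖ₑ⁻¹ * ‖𝓕 (fun x => Φ n x * Ψ n x) ξ‖ₑ) atTop :=
        lintegral_liminf_le hmeas
    _ ≤ liminf (fun n => c * Bg n * Bf n) atTop := liminf_le_liminf (Eventually.of_forall hA)
    _ = c * Sg * Sf := hlim.liminf_eq

end MainEstimate

end Literature.Analysis.FluidPDE

end
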